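import Mathlib
import HarnessLib
import Summits.ResolutionOfSingularities.ResolutionOfSingularities.Theorems.WildQuotientsWildQuotientResolutionZ9PeeledTwistedKL
import Summits.ResolutionOfSingularities.ResolutionOfSingularities.Theorems.WildQuotientsWildQuotientResolutionWeightZeroLocalizationGraded
import Summits.ResolutionOfSingularities.ResolutionOfSingularities.Theorems.WildQuotientsWildQuotientResolutionFixedPointsGraded

/-!
# ℤ9 SPECIMEN (peeled `𝔸⁴/ℤ9`, char 3), brick Z4T part 3b-ii: the `μ₄`-GRADING of the twisted root chart
# ring `L = k[x][u⁻¹]` is preserved by `σ̃`, so `L^{σ̃}` is `ZMod 4`-graded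
(crux stmt-ResolutionOfSingularities-15640 `WildQuotients.WildQuotientResolution`, line `Sketch`; S1 =
stmt-ResolutionOfSingularities-17941; chain w45c card-P specimen «peeled 𝔸⁴/ℤ9», V-BR, brick Z4T
(res-L1-w45c-idea-2 `Z4T-TWIST.md` §3 «the commuting μ₄, weights (S,α,γ,w) = (1,1,3,0)»; res-L1-w45c-stub-2
`Z4T-PART3-DESIGN.md`). [OURS · L1 W4.5c] — NOT a statement of any manuscript; AI-produced, kernel-checked ≠
expert-reviewed. Def-free, law-based over `…Z9PeeledTwistedLift`.)

Weight `w₄ : Fin n → ZMod 4`, `w₄ = (α ↦ 1, S ↦ 1, γ ↦ 3, else 0)` (slots `S = X b`, `α = X a`, `γ = X c`,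
`w = X d`); `u = 1 − S⁶α²`, `v = 1 + S³α`, `v' = 1 − S³α` are weighted-homogeneous of weight `0`.

* `isWeightedHomogeneous_u/_v/_v'`, `u_ne_zero'`;
* `twistedLift_map_mem_graded` — for the grading `𝓛` of `L` by homogeneous fractions
  (`TameTransfer.exists_gradedAlgebra_localizationAway`), ANY `σ̃` with the twisted-lift laws maps `𝓛 i` into
  `𝓛 i` (generators: `σ̃S = S·v ∈ 𝓛₁`, `σ̃α = α·iv⁴ ∈ 𝓛₁`, `σ̃γ = γ·iv + S³v' ∈ 𝓛₃`, `σ̃w ∈ 𝓛₀`, passengers,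
  `σ̃(u⁻¹) = v³u⁻¹ ∈ 𝓛₀`; then monomials by the graded-monoid law and `IsWeightedHomogeneous.induction_on`);
* **`exists_gradedAlgebra_twistedLift_fixedPoints`** — `L^{σ̃} = FixedPoints.subalgebra k L (zpowers σ̃)` carries a
  `GradedAlgebra 𝒮` indexed by `ZMod 4` with `s ∈ 𝒮 i ↔ ∃ m f, f` `w₄`-homogeneous of weight `i ∧ s = ι f·u⁻ᵐ`
  (B1″ `TameTransfer.exists_gradedAlgebra_fixedPoints_zpowers`). With `twistedLift_fixedPoints_isRegularRing` /
  `_finiteType` this is the `(A, S, 𝒮)` part of the V-BR chart datum of the piece `P_T`; the seam `𝒮 0 ≃ Γ(P_T)^{σ̄}`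
  is part 3b-iii.
-/

-- single-problem summit: the doubled namespace component `ResolutionOfSingularities` is forced
set_option linter.dupNamespace false

noncomputable section

open MvPolynomial

namespace Summit.ResolutionOfSingularities.ResolutionOfSingularities.Theorems.WildQuotientResolution.Z9Peeled

variable (k : Type) [Field k] (n : ℕ) (a b c d : Fin n)

/-- The `μ₄`-weight `w₄ = (α ↦ 1, S ↦ 1, γ ↦ 3, else 0)` (local shorthand). -/
local notation3 "wT" => (fun i : Fin n => if i = a then (1 : ZMod 4) else if i = b then 1 else if i = c then 3
  else 0)
/-- `u = 1 − S⁶α²` (local shorthand). -/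
local notation3 "uT" => (1 - X b ^ 6 * X a ^ 2 : MvPolynomial (Fin n) k)
/-- `v = 1 + S³α` (local shorthand). -/
local notation3 "vT" => (1 + X b ^ 3 * X a : MvPolynomial (Fin n) k)
/-- `v' = 1 − S³α` (local shorthand). -/
local notation3 "vT'" => (1 - X b ^ 3 * X a : MvPolynomial (Fin n) k)
/-- The twisted root chart ring `L = k[x][u⁻¹]` (local shorthand). -/
local notation3 "LT" => Localization.Away (1 - X b ^ 6 * X a ^ 2 : MvPolynomial (Fin n) k)
/-- `ι : k[x] → L` (local shorthand). -/
local notation3 "ιT" => algebraMap (MvPolynomial (Fin n) k)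
  (Localization.Away (1 - X b ^ 6 * X a ^ 2 : MvPolynomial (Fin n) k))
/-- `J = u⁻¹ ∈ L` (local shorthand). -/
local notation3 "JT" => (IsLocalization.Away.invSelf (1 - X b ^ 6 * X a ^ 2 : MvPolynomial (Fin n) k) :
  Localization.Away (1 - X b ^ 6 * X a ^ 2 : MvPolynomial (Fin n) k))
/-- `iv = ι v'·J` (local shorthand). -/
local notation3 "ivT" => (algebraMap (MvPolynomial (Fin n) k)
  (Localization.Away (1 - X b ^ 6 * X a ^ 2 : MvPolynomial (Fin n) k)) (1 - X b ^ 3 * X a) *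
    (IsLocalization.Away.invSelf (1 - X b ^ 6 * X a ^ 2 : MvPolynomial (Fin n) k) :
      Localization.Away (1 - X b ^ 6 * X a ^ 2 : MvPolynomial (Fin n) k)))

section weights
variable {k n a b c}

/-- Weighted-homogeneous polynomials of the same weight are closed under subtraction. [folklore] -/
theorem isWeightedHomogeneous_sub {M : Type} [AddCommMonoid M] {w : Fin n → M} {m : M}
    {p q : MvPolynomial (Fin n) k} (hp : IsWeightedHomogeneous w p m) (hq : IsWeightedHomogeneous w q m) :
    IsWeightedHomogeneous w (p - q) m :=
  (mem_weightedHomogeneousSubmodule k w m _).mp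
    (Submodule.sub_mem _ ((mem_weightedHomogeneousSubmodule k w m _).mpr hp)
      ((mem_weightedHomogeneousSubmodule k w m _).mpr hq))

/-- `S = X b` has weight `1`. -/
theorem isWeightedHomogeneous_X_b : IsWeightedHomogeneous wT (X b : MvPolynomial (Fin n) k) 1 := by
  have h := isWeightedHomogeneous_X (R := k) wT b
  by_cases hba : b = a
  · simpa [hba] using h
  · simpa [hba] using h

/-- `α = X a` has weight `1`. -/
theorem isWeightedHomogeneous_X_a : IsWeightedHomogeneous wT (X a : MvPolynomial (Fin n) k) 1 := by
  simpa using isWeightedHomogeneous_X (R := k) wT a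

/-- `γ = X c` has weight `3` (`c ≠ a, b`). -/
theorem isWeightedHomogeneous_X_c (hac : a ≠ c) (hbc : b ≠ c) :
    IsWeightedHomogeneous wT (X c : MvPolynomial (Fin n) k) 3 := by
  simpa [hac.symm, hbc.symm] using isWeightedHomogeneous_X (R := k) wT c

/-- `S³α` has weight `0`. -/
theorem isWeightedHomogeneous_S3A :
    IsWeightedHomogeneous wT (X b ^ 3 * X a : MvPolynomial (Fin n) k) 0 := by
  have h := (isWeightedHomogeneous_X_b (k := k) (a := a) (c := c)).pow 3 |>.mul
    (isWeightedHomogeneous_X_a (k := k) (b := b) (c := c))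
  have e : (3 • (1 : ZMod 4) + 1) = 0 := by decide
  rwa [e] at h

/-- `v = 1 + S³α` has weight `0`. -/
theorem isWeightedHomogeneous_v : IsWeightedHomogeneous wT vT 0 :=
  (isWeightedHomogeneous_one k wT).add isWeightedHomogeneous_S3A

/-- `v' = 1 − S³α` has weight `0`. -/
theorem isWeightedHomogeneous_v' : IsWeightedHomogeneous wT vT' 0 :=
  isWeightedHomogeneous_sub (isWeightedHomogeneous_one k wT) isWeightedHomogeneous_S3A

/-- `u = 1 − S⁶α²` has weight `0`. -/
theorem isWeightedHomogeneous_u : IsWeightedHomogeneous wT uT 0 := by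
  have h := (isWeightedHomogeneous_X_b (k := k) (a := a) (c := c)).pow 6 |>.mul
    ((isWeightedHomogeneous_X_a (k := k) (b := b) (c := c)).pow 2)
  have e : (6 • (1 : ZMod 4) + 2 • (1 : ZMod 4)) = 0 := by decide
  rw [e] at h
  exact isWeightedHomogeneous_sub (isWeightedHomogeneous_one k wT) h

end weights

-- generator-by-generator membership + the monomial induction; head-room
set_option maxHeartbeats 1600000 in
/-- **`σ̃` preserves the grading of `L` by homogeneous fractions.** [OURS · L1 W4.5c] -/
theorem twistedLift_map_mem_graded [CharP k 3] (σt : LT ≃ₐ[k] LT)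
    (hS : σt (ιT (X b)) = ιT (X b * vT)) (hA : σt (ιT (X a)) = ιT (X a) * ivT ^ 4)
    (hG : σt (ιT (X c)) = ιT (X c) * ivT + ιT (X b ^ 3 * vT'))
    (hW : σt (ιT (X d)) = ιT (X d + X b ^ 3 * X c ^ 3 - X b ^ 15 * X a ^ 2 * uT ^ 2 * X c))
    (hfix : ∀ i, i ≠ a → i ≠ b → i ≠ c → i ≠ d → σt (ιT (X i)) = ιT (X i))
    (hac : a ≠ c) (had : a ≠ d) (hbc : b ≠ c) (hbd : b ≠ d) (hcd : c ≠ d)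
    (𝓛 : ZMod 4 → Submodule k LT) [GradedAlgebra 𝓛]
    (hmem : ∀ (i : ZMod 4) (y : LT), y ∈ 𝓛 i ↔ ∃ (m : ℕ) (f : MvPolynomial (Fin n) k),
      IsWeightedHomogeneous wT f i ∧ y = ιT f * JT ^ m)
    (i : ZMod 4) (y : LT) (hy : y ∈ 𝓛 i) : σt y ∈ 𝓛 i := by
  classical
  let τ : LT →ₐ[k] LT := σt
  -- homogeneous polynomials land in their piece
  have hpoly : ∀ (j : ZMod 4) (f : MvPolynomial (Fin n) k), IsWeightedHomogeneous wT f j →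
      ιT f ∈ 𝓛 j := fun j f hf => (hmem j _).mpr ⟨0, f, hf, by rw [pow_zero, mul_one]⟩
  have hJ0 : JT ∈ 𝓛 0 := (hmem 0 _).mpr ⟨1, 1, isWeightedHomogeneous_one k wT, by rw [map_one, one_mul, pow_one]⟩
  have hiv : ivT ∈ 𝓛 0 := by
    have h := SetLike.mul_mem_graded (hpoly 0 _ isWeightedHomogeneous_v') hJ0
    rwa [add_zero] at h
  -- the generators
  have hXb : σt (ιT (X b)) ∈ 𝓛 1 := by
    rw [hS]
    have h := (isWeightedHomogeneous_X_b (k := k) (a := a) (c := c)).mul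
      (isWeightedHomogeneous_v (k := k) (a := a) (b := b) (c := c))
    rw [add_zero] at h
    exact hpoly 1 _ h
  have hXa : σt (ιT (X a)) ∈ 𝓛 1 := by
    rw [hA]
    have h := SetLike.mul_mem_graded (hpoly 1 _ (isWeightedHomogeneous_X_a (k := k) (b := b) (c := c)))
      (SetLike.pow_mem_graded 4 hiv)
    simp only [smul_zero, add_zero] at h
    exact h
  have hXc : σt (ιT (X c)) ∈ 𝓛 3 := by
    rw [hG]
    refine Submodule.add_mem _ ?_ ?_
    · have h := SetLike.mul_mem_graded (hpoly 3 _ (isWeightedHomogeneous_X_c (k := k) hac hbc)) hiv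
      rwa [add_zero] at h
    · have h := ((isWeightedHomogeneous_X_b (k := k) (a := a) (c := c)).pow 3).mul
        (isWeightedHomogeneous_v' (k := k) (a := a) (b := b) (c := c))
      have e : (3 • (1 : ZMod 4) + 0) = 3 := by decide
      rw [e] at h
      exact hpoly 3 _ h
  have hXd : σt (ιT (X d)) ∈ 𝓛 0 := by
    rw [hW]
    refine hpoly 0 _ ?_
    have hd0 : IsWeightedHomogeneous wT (X d : MvPolynomial (Fin n) k) 0 := by
      simpa [had.symm, hbd.symm, hcd.symm] using isWeightedHomogeneous_X (R := k) wT d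
    have h1 : IsWeightedHomogeneous wT (X b ^ 3 * X c ^ 3 : MvPolynomial (Fin n) k) 0 := by
      have h := ((isWeightedHomogeneous_X_b (k := k) (a := a) (c := c)).pow 3).mul
        ((isWeightedHomogeneous_X_c (k := k) hac hbc).pow 3)
      have e : (3 • (1 : ZMod 4) + 3 • (3 : ZMod 4)) = 0 := by decide
      rwa [e] at h
    have h2 : IsWeightedHomogeneous wT (X b ^ 15 * X a ^ 2 * uT ^ 2 * X c : MvPolynomial (Fin n) k) 0 := by
      have h := ((((isWeightedHomogeneous_X_b (k := k) (a := a) (c := c)).pow 15).mul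
        ((isWeightedHomogeneous_X_a (k := k) (b := b) (c := c)).pow 2)).mul
        ((isWeightedHomogeneous_u (k := k) (a := a) (b := b) (c := c)).pow 2)).mul
        (isWeightedHomogeneous_X_c (k := k) hac hbc)
      have e : (15 • (1 : ZMod 4) + 2 • (1 : ZMod 4) + 2 • (0 : ZMod 4) + 3) = 0 := by decide
      rwa [e] at h
    exact isWeightedHomogeneous_sub (hd0.add h1) h2
  have hX : ∀ j : Fin n, σt (ιT (X j)) ∈ 𝓛 (wT j) := by
    intro j
    by_cases hja : j = a
    · subst hja; simpa using hXa
    by_cases hjb : j = b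
    · subst hjb; simpa [hja] using hXb
    by_cases hjc : j = c
    · subst hjc; simpa [hja, hjb] using hXc
    by_cases hjd : j = d
    · subst hjd; simpa [hja, hjb, hjc] using hXd
    · rw [hfix j hja hjb hjc hjd]
      exact hpoly _ _ (isWeightedHomogeneous_X (R := k) wT j)
  -- homogeneous polynomials
  have hP : ∀ (j : ZMod 4) (f : MvPolynomial (Fin n) k), IsWeightedHomogeneous wT f j →
      σt (ιT f) ∈ 𝓛 j := by
    intro j f hf
    induction hf using IsWeightedHomogeneous.induction_on with
    | zero => rw [map_zero, map_zero]; exact Submodule.zero_mem _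
    | add p q hp hq ihp ihq => rw [map_add, map_add]; exact Submodule.add_mem _ ihp ihq
    | monomial e r hr =>
      rw [MvPolynomial.monomial_eq, map_mul, map_mul, Finsupp.prod, map_prod, map_prod]
      have hC : σt (ιT (C r)) = algebraMap k LT r := by
        rw [← MvPolynomial.algebraMap_eq, ← IsScalarTower.algebraMap_apply, AlgEquiv.commutes]
      rw [hC, ← Algebra.smul_def]
      refine Submodule.smul_mem _ r ?_
      have hprod := SetLike.prod_mem_graded (A := 𝓛) (F := e.support) (i := fun j => e j • wT j)
        (g := fun j => σt (ιT (X j ^ e j))) (fun j _ => by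
          rw [map_pow, map_pow]; exact SetLike.pow_mem_graded (e j) (hX j))
      have hw : (∑ j ∈ e.support, e j • wT j) = j := by
        rw [← hr, Finsupp.weight_apply, Finsupp.sum]
      rwa [hw] at hprod
  -- `σ̃ (u⁻¹) = v³ u⁻¹ ∈ 𝓛 0`
  have hJ : σt JT ∈ 𝓛 0 := by
    have e : σt JT = ιT vT ^ 3 * JT := lift_apply_J k n a b τ hS hA
    rw [e, ← map_pow]
    have hv3 : IsWeightedHomogeneous wT (vT ^ 3) 0 := by
      have h := (isWeightedHomogeneous_v (k := k) (a := a) (b := b) (c := c)).pow 3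
      simp only [smul_zero] at h
      exact h
    have h := SetLike.mul_mem_graded (hpoly 0 _ hv3) hJ0
    simp only [add_zero] at h
    exact h
  -- assemble
  obtain ⟨m, f, hf, rfl⟩ := (hmem i y).mp hy
  rw [map_mul, map_pow]
  have h := SetLike.mul_mem_graded (hP i f hf) (SetLike.pow_mem_graded m hJ)
  simp only [smul_zero, add_zero] at h
  exact h

-- the two packaged `∃`-gradings are unpacked and repacked over the long law binders; head-room
set_option maxHeartbeats 1600000 in
/-- **`L^{σ̃}` is `ZMod 4`-graded** by the `μ₄`-weight (pieces = invariant homogeneous fractions).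
[OURS · L1 W4.5c] -/
theorem exists_gradedAlgebra_twistedLift_fixedPoints [CharP k 3] (σt : LT ≃ₐ[k] LT)
    (hS : σt (ιT (X b)) = ιT (X b * vT)) (hA : σt (ιT (X a)) = ιT (X a) * ivT ^ 4)
    (hG : σt (ιT (X c)) = ιT (X c) * ivT + ιT (X b ^ 3 * vT'))
    (hW : σt (ιT (X d)) = ιT (X d + X b ^ 3 * X c ^ 3 - X b ^ 15 * X a ^ 2 * uT ^ 2 * X c))
    (hfix : ∀ i, i ≠ a → i ≠ b → i ≠ c → i ≠ d → σt (ιT (X i)) = ιT (X i))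
    (hac : a ≠ c) (had : a ≠ d) (hbc : b ≠ c) (hbd : b ≠ d) (hcd : c ≠ d) :
    ∃ (𝒮 : ZMod 4 → Submodule k (FixedPoints.subalgebra k LT (Subgroup.zpowers σt)))
      (_ : GradedAlgebra 𝒮),
      ∀ (i : ZMod 4) (s : FixedPoints.subalgebra k LT (Subgroup.zpowers σt)), s ∈ 𝒮 i ↔
        ∃ (m : ℕ) (f : MvPolynomial (Fin n) k), IsWeightedHomogeneous wT f i ∧
          (s : LT) = ιT f * JT ^ m := by
  classical
  have hu : IsWeightedHomogeneous wT uT 0 := isWeightedHomogeneous_u (k := k) (a := a) (b := b) (c := c)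
  obtain ⟨𝓛, inst𝓛, hmem⟩ := TameTransfer.exists_gradedAlgebra_localizationAway (k := k) wT uT hu
    (u_ne_zero k n a b)
  haveI := inst𝓛
  have hσ : ∀ (i : ZMod 4) (y : LT), y ∈ 𝓛 i → σt y ∈ 𝓛 i := fun i y hy =>
    twistedLift_map_mem_graded k n a b c d σt hS hA hG hW hfix hac had hbc hbd hcd 𝓛 hmem i y hy
  obtain ⟨𝒮, inst𝒮, h𝒮⟩ := TameTransfer.exists_gradedAlgebra_fixedPoints_zpowers 𝓛 σt hσ
  exact ⟨𝒮, inst𝒮, fun i s => (h𝒮 i s).trans (hmem i s)⟩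

end Summit.ResolutionOfSingularities.ResolutionOfSingularities.Theorems.WildQuotientResolution.Z9Peeled

end
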